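import Summits.AtomisticToContinuum.HydrodynamicLimit.Theorems.AntiMazurCoboundariesKineticWindowGronwallWindowClauseOfRenyi
import Summits.AtomisticToContinuum.HydrodynamicLimit.Theorems.AntiMazurCoboundariesKineticWindowGronwallPlusNode
import HarnessLib

/-!
# The local kinetic node from its ONE-BAND version and the Rényi quasi-invariance of the local Gibbs class
# (stub `stub_nodeOfBandAndRenyi`, skeleton v3 of line `board-node-dock`, crux `KineticWindowGronwall`, stmt-AtomisticToContinuum-9282)

Crux `Summit.AtomisticToContinuum.HydrodynamicLimit.Theses.AntiMazurCoboundaries.KineticWindowGronwall`. Skeleton v3 of the line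
RESHAPES its load-bearing stub `KineticWindowGronwallPlusNode.KineticWindowLDBoundsUniform` (the bounds-uniform local kinetic node) into
* `KineticWindowLDBoundsBand` — the node with its window clause `∃ τ₀ ∀ τ ≥ τ₀` replaced by ONE BAND of windows `∃ τ₀ ∀ τ ∈ [τ₀, 2τ₀]`
  (the engine: contents (i) one-window pressure-level locality and (ii) density direction of the tilt radius), and
* `WindowRenyiLocalGibbs` — order-`p` Rényi quasi-invariance of the local Gibbs laws of the bounded class over kinetic windows, with ONE
  order `p > 1` per `(θm, θM, U, σ)` (content (iii); PROVED for density-only data, `KineticWindowGronwallDensityOnlyWindowRenyi`; reduced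
  for general data to the exponential tightness of the kinetic-window increments of `energyObservable θ₀⁻¹` and
  `momentumObservable (u₀/θ₀)`, `WindowRenyiOfIncrementTightness`),
and this file proves the composition `node_of_band_and_renyi : KineticWindowLDBoundsBand → WindowRenyiLocalGibbs →
KineticWindowLDBoundsUniform` (tilt radius `β₀/q`, `q = p/(p−1)`; packing guard `min η₀ η₁`): the pointwise form of the landed
`KineticWindowGronwallWindowClauseOfRenyi.stub_windowClauseOfRenyi` — `k = ⌊τ/τ₀⌋₊` shifted sub-windows, generalised Hölder,
Rényi–Hölder transfer of each factor (`ewm_mul_le`), the band bound used only at `(qβ, ε, τ/k)`. Folklore; no named fact is used.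
-/

noncomputable section

namespace Summit.AtomisticToContinuum.HydrodynamicLimit.Theorems.KineticWindowGronwallNodeOfBandAndRenyi

open _root_.MeasureTheory _root_.Set _root_.Filter
open scoped _root_.ENNReal
open Literature.Analysis.FluidPDE Literature.MathematicalPhysics.KineticTheory
open Summit.AtomisticToContinuum.HydrodynamicLimit.Theorems.KineticWindowGronwallWindowClauseOfRenyi
  (TFlow lgDensity windowMoment ewm windowMoment_eq_ewm ewm_mul_le exists_subwindows)
open Summit.AtomisticToContinuum.HydrodynamicLimit.Theorems.KineticWindowGronwallPlusNode (KineticWindowLDBoundsUniform)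

/-! ## §1 Statements (verbatim in the skeleton v3 `Cruxes/KineticWindowGronwall/Lines/board_node_dock.lean`) -/

/-- **THE ONE-BAND LOCAL KINETIC NODE** (stub `stub_kineticWindowLDBoundsBand` of skeleton v3): verbatim
`KineticWindowGronwallPlusNode.KineticWindowLDBoundsUniform` with the window clause `∃ τ₀ > 0, ∀ τ ≥ τ₀` replaced by
`∃ τ₀ > 0, ∀ τ ∈ [τ₀, 2τ₀]` — window LD for every continuous fast `F(x,v)` of quadratic growth orthogonal at every `x` to the
collision invariants under the local Maxwellian, under local Gibbs laws with the packing guard, ONE tilt radius `β₀(θm, θM, U, σ)`,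
thresholds pointwise. Conjecture-grade (open problem: the engine). -/
def KineticWindowLDBoundsBand : Prop :=
  ∃ η₀ : ℝ, 0 < η₀ ∧ ∀ (θm θM U : ℝ), 0 < θm → θm ≤ θM → 0 ≤ U → ∀ σ : ℝ, 0 < σ →
    ∃ β₀ : ℝ, 0 < β₀ ∧
    ∀ (a θ₀ : T3 → ℝ) (u₀ : T3 → V3), Continuous a → Continuous θ₀ → Continuous u₀ →
    (∀ x, 0 < a x) → (∀ x, θm ≤ θ₀ x) → (∀ x, θ₀ x ≤ θM) → (∀ x, ‖u₀ x‖ ≤ U) →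
    σ ^ 3 * (⨆ x, a x) ≤ η₀ * ∫ x, a x →
    ∀ Φ : (N : ℕ) → TFlow σ N,
    ∀ F : T3 × V3 → ℝ, Continuous F → (∀ y, |F y| ≤ 1 + ‖y.2‖ ^ 2) →
      (∀ x, ∫ v, F (x, v) * localMaxwellian 1 (θ₀ x) (u₀ x) v = 0) →
      (∀ x (j : Fin 3), ∫ v, F (x, v) * v j * localMaxwellian 1 (θ₀ x) (u₀ x) v = 0) →
      (∀ x, ∫ v, F (x, v) * ‖v‖ ^ 2 * localMaxwellian 1 (θ₀ x) (u₀ x) v = 0) →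
      ∀ β : ℝ, |β| ≤ β₀ → ∀ ε : ℝ, 0 < ε → ∃ τ₀ : ℝ, 0 < τ₀ ∧ ∀ τ ∈ Icc τ₀ (2 * τ₀), ∃ N₀ : ℕ, ∀ N : ℕ, N₀ ≤ N →
        windowMoment σ a θ₀ u₀ Φ F N τ β ≤ ENNReal.ofReal (Real.exp (ε * ((N : ℝ) + 1)))

/-- **RÉNYI QUASI-INVARIANCE OF THE LOCAL GIBBS CLASS OVER KINETIC WINDOWS** (stub `stub_windowRenyiLocalGibbs` of skeleton v3):
there is a packing guard `η₁ > 0` such that for every temperature range, drift bound and `σ > 0` there is ONE order `p > 1` such that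
for every continuous datum of the class (with the guard) and every flow family the order-`p` Rényi integrals of the time-shifted local
Gibbs laws are `≤ e^{ε(N+1)}` eventually in `N`, uniformly over shifts `0 ≤ s ≤ τ(N+1)^{-1/3}`. PROVED for density-only data
(`stub_densityOnlyWindowRenyi`, every `p`); for general data it is the open dynamic input of content (iii)
(`WindowRenyiOfIncrementTightness`). Conjecture-grade. -/
def WindowRenyiLocalGibbs : Prop :=
  ∃ η₁ : ℝ, 0 < η₁ ∧ ∀ (θm θM U : ℝ), 0 < θm → θm ≤ θM → 0 ≤ U → ∀ σ : ℝ, 0 < σ →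
    ∃ p : ℝ, 1 < p ∧
    ∀ (a θ₀ : T3 → ℝ) (u₀ : T3 → V3), Continuous a → Continuous θ₀ → Continuous u₀ →
    (∀ x, 0 < a x) → (∀ x, θm ≤ θ₀ x) → (∀ x, θ₀ x ≤ θM) → (∀ x, ‖u₀ x‖ ≤ U) →
    σ ^ 3 * (⨆ x, a x) ≤ η₁ * ∫ x, a x →
    ∀ Φ : (N : ℕ) → TFlow σ N,
    ∀ τ ε : ℝ, 0 < τ → 0 < ε → ∃ N₀ : ℕ, ∀ N : ℕ, N₀ ≤ N → ∀ s : ℝ, 0 ≤ s →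
      s ≤ τ * ((N : ℝ) + 1) ^ (-(1 / 3 : ℝ)) →
      ∫⁻ z, (lgDensity σ a θ₀ u₀ N ((Φ N).flow (-s) z) / lgDensity σ a θ₀ u₀ N z) ^ p
          ∂(localGibbsLaw σ a u₀ θ₀ N (Φ N)) ≤ ENNReal.ofReal (Real.exp (ε * ((N : ℝ) + 1)))

/-- Helper statement `NodeOfBandAndRenyi` (registered helper stub `stub_nodeOfBandAndRenyi`): the one-band node and the Rényi
quasi-invariance of the class give the node. Route-internal, not a cited fact. -/
def NodeOfBandAndRenyi : Prop :=
  KineticWindowLDBoundsBand → WindowRenyiLocalGibbs → KineticWindowLDBoundsUniform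

/-! ## §2 The window clause, pointwise form -/

/-- **The window clause from ONE band, pointwise in `(β, ε)`** (the hypothesis of the landed `stub_windowClauseOfRenyi` is used only at
`(qβ, ε, τ/k)`): for continuous data with `a, θ₀ > 0`, a flow family, a continuous `F`, conjugate `p, q`, the Rényi bound (R) at
order `p`, a tilt `β`, a precision `ε` and a band start `τ₀ > 0`: if the window moment at tilt `qβ` is `≤ e^{ε(N+1)}` eventually for
every `τ' ∈ [τ₀, 2τ₀]`, then the window moment at tilt `β` is `≤ e^{ε(N+1)}` eventually for every `τ ≥ τ₀`. [folklore] -/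
theorem windowClause_pointwise {σ : ℝ} {a θ₀ : T3 → ℝ} {u₀ : T3 → V3} (ha : Continuous a) (hθ : Continuous θ₀)
    (hu : Continuous u₀) (ha0 : ∀ x, 0 < a x) (hθ0 : ∀ x, 0 < θ₀ x) (Φ : (N : ℕ) → TFlow σ N) {F : T3 × V3 → ℝ}
    (hF : Continuous F) {p q : ℝ} (hpq : p.HolderConjugate q)
    (hR : ∀ τ ε : ℝ, 0 < τ → 0 < ε → ∃ N₀ : ℕ, ∀ N : ℕ, N₀ ≤ N → ∀ s : ℝ, 0 ≤ s →
      s ≤ τ * ((N : ℝ) + 1) ^ (-(1 / 3 : ℝ)) →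
      ∫⁻ z, (lgDensity σ a θ₀ u₀ N ((Φ N).flow (-s) z) / lgDensity σ a θ₀ u₀ N z) ^ p
        ∂(localGibbsLaw σ a u₀ θ₀ N (Φ N)) ≤ ENNReal.ofReal (Real.exp (ε * ((N : ℝ) + 1))))
    {β ε τ₀ : ℝ} (hε : 0 < ε) (hτ₀ : 0 < τ₀)
    (hW : ∀ τ' ∈ Icc τ₀ (2 * τ₀), ∃ N₀ : ℕ, ∀ N : ℕ, N₀ ≤ N →
      windowMoment σ a θ₀ u₀ Φ F N τ' (q * β) ≤ ENNReal.ofReal (Real.exp (ε * ((N : ℝ) + 1))))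
    {τ : ℝ} (hτ : τ₀ ≤ τ) :
    ∃ N₀ : ℕ, ∀ N : ℕ, N₀ ≤ N → windowMoment σ a θ₀ u₀ Φ F N τ β ≤ ENNReal.ofReal (Real.exp (ε * ((N : ℝ) + 1))) := by
  obtain ⟨k, hk, hτ'⟩ := exists_subwindows hτ₀ hτ
  have hkR : (k : ℝ) ≠ 0 := Nat.cast_ne_zero.mpr hk.ne'
  obtain ⟨N₁, hN₁⟩ := hR τ ε (hτ₀.trans_le hτ) hε
  obtain ⟨N₂, hN₂⟩ := hW (τ / k) hτ'
  refine ⟨max N₁ N₂, fun N hN => ?_⟩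
  have hc : 0 < ((N : ℝ) + 1) ^ (-(1 / 3 : ℝ)) := Real.rpow_pos_of_pos (by positivity) _
  have hw : 0 ≤ τ / k * ((N : ℝ) + 1) ^ (-(1 / 3 : ℝ)) :=
    mul_nonneg (div_nonneg (hτ₀.le.trans hτ) (Nat.cast_nonneg k)) hc.le
  have hkw : (k : ℝ) * (τ / k * ((N : ℝ) + 1) ^ (-(1 / 3 : ℝ))) = τ * ((N : ℝ) + 1) ^ (-(1 / 3 : ℝ)) := by
    rw [← mul_assoc, mul_div_cancel₀ _ hkR]
  rw [windowMoment_eq_ewm, ← hkw]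
  refine ewm_mul_le ha hθ hu ha0 hθ0 (Φ N) hF hpq hk hw β (fun s hs0 hs1 => hN₁ N (le_of_max_le_left hN) s hs0 ?_) ?_
  · rwa [hkw] at hs1
  · rw [← windowMoment_eq_ewm]
    exact hN₂ N (le_of_max_le_right hN)

/-! ## §3 The composition -/

/-- **The node from the one-band node and the Rényi quasi-invariance of the class**: packing guard `min η₀ η₁`, tilt radius
`β₀/q` with `q = p/(p−1)` conjugate to the order `p(θm, θM, U, σ)`; for `|β| ≤ β₀/q` run the band node at `(qβ, ε)` and upgrade its
band `[τ₀, 2τ₀]` to all `τ ≥ τ₀` by `windowClause_pointwise`. [folklore] -/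
theorem node_of_band_and_renyi (hB : KineticWindowLDBoundsBand) (hRc : WindowRenyiLocalGibbs) : KineticWindowLDBoundsUniform := by
  obtain ⟨η₀, hη₀, HB⟩ := hB
  obtain ⟨η₁, hη₁, HR⟩ := hRc
  refine ⟨min η₀ η₁, lt_min hη₀ hη₁, fun θm θM U hθm hθmM hU σ hσ => ?_⟩
  obtain ⟨β₀, hβ₀, Hβ⟩ := HB θm θM U hθm hθmM hU σ hσ
  obtain ⟨p, hp, Hp⟩ := HR θm θM U hθm hθmM hU σ hσ
  -- the conjugate exponent `q = p/(p−1)`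
  set q : ℝ := p / (p - 1) with hq
  have hpq : p.HolderConjugate q := by
    rw [Real.holderConjugate_iff]
    refine ⟨hp, ?_⟩
    rw [hq]
    field_simp
    ring
  have hq0 : 0 < q := hpq.symm.pos
  refine ⟨β₀ / q, div_pos hβ₀ hq0, ?_⟩
  intro a θ₀ u₀ ha hθ hu ha0 hθm_le hθM_ge hU_le hguard Φ F hFc hFb hO1 hO2 hO3 β hβ ε hε
  have hθ0 : ∀ x, 0 < θ₀ x := fun x => hθm.trans_le (hθm_le x)
  have hint : 0 ≤ ∫ x, a x := integral_nonneg fun x => (ha0 x).le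
  have hguard₀ : σ ^ 3 * (⨆ x, a x) ≤ η₀ * ∫ x, a x :=
    hguard.trans (mul_le_mul_of_nonneg_right (min_le_left _ _) hint)
  have hguard₁ : σ ^ 3 * (⨆ x, a x) ≤ η₁ * ∫ x, a x :=
    hguard.trans (mul_le_mul_of_nonneg_right (min_le_right _ _) hint)
  -- the band node at tilt `qβ`
  have hqβ : |q * β| ≤ β₀ := by
    rw [abs_mul, abs_of_pos hq0]
    calc q * |β| ≤ q * (β₀ / q) := mul_le_mul_of_nonneg_left hβ hq0.le
      _ = β₀ := mul_div_cancel₀ _ hq0.ne'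
  obtain ⟨τ₀, hτ₀, Hτ⟩ := Hβ a θ₀ u₀ ha hθ hu ha0 hθm_le hθM_ge hU_le hguard₀ Φ F hFc hFb hO1 hO2 hO3 (q * β) hqβ ε hε
  refine ⟨τ₀, hτ₀, fun τ hτ => ?_⟩
  exact windowClause_pointwise ha hθ hu ha0 hθ0 Φ hFc hpq
    (Hp a θ₀ u₀ ha hθ hu ha0 hθm_le hθM_ge hU_le hguard₁ Φ) hε hτ₀ Hτ hτ

/-- **Registered helper stub `stub_nodeOfBandAndRenyi`**: `NodeOfBandAndRenyi` holds. [folklore] -/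
theorem stub_nodeOfBandAndRenyi : NodeOfBandAndRenyi :=
  node_of_band_and_renyi

end Summit.AtomisticToContinuum.HydrodynamicLimit.Theorems.KineticWindowGronwallNodeOfBandAndRenyi

end
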